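import Summits.QuantumFields.BalabanUV.T4Continuum.Support.VectorLineComposite
import Summits.QuantumFields.BalabanUV.T4Continuum.Support.VariationalVectorEffective
import Summits.QuantumFields.BalabanUV.T4Continuum.Support.VariationalColourTower

/-!
# T⁴ programme, spine node NE2 (U1a), lane P2 — SUPPLIER LEAF V-COMP IN TOWER SHAPE FOR 1-FORMS: transport of the fine VECTOR objects along the
# block nesting `sites`, `blockSpin (Q_T ∘ Q_{T′}) SfV = blockSpin Q_{T⊛T′} ScV_{n·L}` on the composite ∕ transported data, the averaging MATRIX of the
# line-indexed class `QvL` at `E = ℂ`, and THE VECTOR TOWER END `towerLimitRate_effV` INSTANTIATED ON THE `QvL` CARRIERS (modulo the vector leaves)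

NE2 formalisation swarm `b2b-balaban-t4-ne2-formalise-*`, leaf prover 10 GEN 3 (`prover-b2b-balaban-t4-ne2-formalise-leaf-10-g3-0`), supplier work on
road P2's register (journal CLAIMS.log 2026-08-20 «INTENT ∕ CLAIM V-COMP (TOWER)»): the retired road owner's OPEN list («then instantiate
`towerLimitRate_effV` (Qm := the matrix of `QvL (T k)`) ⟹ the vector END») and the displayed clause of `VariationalVectorEffective` §5 («the conclusion
of `vector_pair_bracket_sqrt` composed with leaf V-COMP's identification of level `k+1` with the composite»).  This file is the VECTOR TWIN of
leaf-02-g3's scalar `VariationalCovariantTower` §1–§4, on top of leaf-03-g4's one-step identity `VectorLineComposite.QvL_comp` (V-COMP-L: the line-indexed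
class is closed under composition, `compL`), the owner's `VariationalVectorForm` (`cdV`, `curlSq`, `ScV`, `SfV`, `qWV`, `qVV`) ∕ `VariationalVectorEffective`
(`unc`, `cur`, `avg`, `effV`, `towerLimitRate_effV`) and leaf-02-g4's `VariationalColourTower.Rtrv` — all BY NAME.
 * §1 TRANSPORT along `sites n L M : Tor (fine (n·L) M) ≃ Tor (fine L (fine n M))` (the tree's (1.16)–(1.18) reindexing `B5Composition116.sites`):
   `cdV_transport`, `curlSq_transport`, `nsqV_transport`, `roughV_transport`, the transported gauge∕curvature functional `Gtr G′ W := G′ (W ∘ sites⁻¹)`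
   ((GF0), continuity and (GF1′) pass: `Gtr_nonneg`, `continuous_Gtr`, `Gtr_rough_le`), **`SfV_eq_transport : SfV n L M R′ G′ W′ =
   ScV (n·L) M (Rtrv R′) (Gtr G′) (W′ ∘ sites)`**, `qVV_eq_transport`, `QvL_comp_symm`, `coerciveV_transport` (leaf V-P's shape passes to the composite data);
 * §2 **`blockSpin_vector_pair_transport`**: the FINE member of the vector canonical pair at level `n` IS the coarse vector block-spin value at level `n·L` on the
   composite line transports `compL T T′`, the transported bond transports `Rtrv R′` and `Gtr G′`; `vector_bracket_transport`; tower shape `Q1towV`,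
   `QvL_compL_eq_comp` (`Q_{T⊛T′} = Q_T ∘ Q₁`), `ScV_Rtrv_eq`, `blockSpin_Q1towV`, `ubV_transport`;
 * §3 (`E = ℂ`) `QvLlin` ∕ **`QmL n M T := LinearMap.toMatrix' (QvLlin T)`** with `avg_QmL : avg n M (QmL T) W = QvL n M T W` — the matrix averaging of
   `VariationalVectorEffective` IS the line-indexed class; `QmL_mulVec_surjective`;
 * §4 **`towerLimitRate_effV_of_pairs`**: along `n_k = L^k` with line transports `T k`, one-step line transports `T′ k`, bond transports `R k` ∕ `R′ k`, PSD `Gm k`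
   with `G k = qform (Gm k) ∘ unc`, fine functionals `G′ k`, per-level leaf-V-P shape, `QvL (L^k) M (T k)` onto, the COMP DATA IDENTITIES
   `T (k+1) = compL (L^k) L M (T k) (T′ k)`, `R (k+1) = Rtrv (R′ k)`, `G (k+1) = Gtr (G′ k)` (DISPLAYED; `L^(k+1) = L^k·L` by `rfl`) and the two one-sided additive
   brackets IN THE CONCLUSION SHAPE OF `vector_pair_bracket_sqrt` at `n = L^k` with defects `≤ C·ρ^k`, `ρ < 1` ⟹
   `TowerLimitRate (ι := fun _ ↦ Tor M × Fin d) (fun _ ↦ 1) 1 (k ↦ effV (L^k) M (R k) (Gm k) (QmL (L^k) M (T k)) a) C ρ` — the vector END on the `QvL` carriers,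
   MODULO the vector leaves V-UB ∕ V-P ∕ V-FED ∕ V-ONE ∕ V-REG (they stay the bracket's displayed binders); `oneStepAveragedLaw_effV_of_pairs` likewise.

HONEST FRAMING (T4-DAG p. 1).  Model level: transports (`T`, `T′`, `R`, `R′`), `Gm`, `G`, `G′` are DATA; `E = ℂ` in §3–§4 exactly as in `VariationalVectorEffective`;
[folklore] reindexing and finite-dimensional linear algebra; nothing printed is a hypothesis; nothing of the vector leaves and nothing of node NE3 is proved here; no
B0; data `def`s only (`Gtr`, `Q1towV`, `QvLlin`, `QmL`), no `def … : Prop`, no `sorry`; axioms standard.  NE2 NOT proved; spine 0/9; rung (B)+1 finite T⁴ — NOT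
infinite volume, NOT mass gap, NOT Clay.  HONEST DEPENDENCY (cell, verbatim): continuum YM on T⁴ ⇐ BetaPertH ∧ nine spine estimates (0/9 proved); BetaPertH ⇐
(D1) ∧ (D4) ∧ CAP+tail; G-an2-4 gates asym, D1 and NE2/3/4.
-/

noncomputable section

namespace Summit.QuantumFields.BalabanUV.T4Continuum.VariationalVectorTower

open Finset
open scoped Matrix ComplexConjugate ComplexOrder Matrix.Norms.L2Operator BigOperators
open Literature.MathematicalPhysics.QuantumFieldTheory.Balaban1983to89.B5Prop11Plancherel (Tor fine unitVec)
open Literature.MathematicalPhysics.QuantumFieldTheory.Balaban1983to89.B5Composition116 (sites)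
open Literature.Analysis.Complex (qform)
open Summit.QuantumFields.BalabanUV.T4Continuum.VariationalTransfer (blockSpin)
open Summit.QuantumFields.BalabanUV.T4Continuum.VariationalTower (blockSpin_equiv sites_unitVec)
open Summit.QuantumFields.BalabanUV.T4Continuum.VariationalCovariantTower (sites_add)
open Summit.QuantumFields.BalabanUV.T4Continuum.VariationalColourTower (Rtrv)
open Summit.QuantumFields.BalabanUV.T4Continuum.CovariantAveragingTower (OneStepAveragedLaw TowerLimitRate)
open Summit.QuantumFields.BalabanUV.T4Continuum.VectorBlockTrialForm (nsqV nsqV_nonneg roughV QvL compL QvL_comp)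
open Summit.QuantumFields.BalabanUV.T4Continuum.VariationalVectorForm
open Summit.QuantumFields.BalabanUV.T4Continuum.VariationalVectorEffective

variable {d : ℕ} {E : Type*} [NormedAddCommGroup E] [NormedSpace ℂ E]

/-! ## §1 Transport of the fine vector objects along the block nesting `sites` -/

section Transport

variable (n L : ℕ) [NeZero n] [NeZero L] (M : Fin d → ℕ) [hM : ∀ μ, NeZero (M μ)]

omit [NeZero n] [NeZero L] hM in
/-- the covariant first differences are transported: `D_μ(W′∘sites)_ν(x) = D_μW′_ν(sites x)` for the transported bond transports `Rtrv R′ = R′ ∘ sites`. [folklore] -/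
theorem cdV_transport (R' : Tor (fine L (fine n M)) → Fin d → (E →L[ℂ] E)) (W' : Tor (fine L (fine n M)) → Fin d → E)
    (x : Tor (fine (n * L) M)) (μ ν : Fin d) :
    cdV (fine (n * L) M) (Rtrv n L M R') (W' ∘ sites n L M) x μ ν = cdV (fine L (fine n M)) R' W' (sites n L M x) μ ν := by
  simp only [cdV, Rtrv, Function.comp_apply, sites_add, sites_unitVec]

omit [NeZero n] [NeZero L] hM in
/-- the covariant curl is transported. [folklore] -/
theorem curlV_transport (R' : Tor (fine L (fine n M)) → Fin d → (E →L[ℂ] E)) (W' : Tor (fine L (fine n M)) → Fin d → E)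
    (x : Tor (fine (n * L) M)) (μ ν : Fin d) :
    curlV (fine (n * L) M) (Rtrv n L M R') (W' ∘ sites n L M) x μ ν = curlV (fine L (fine n M)) R' W' (sites n L M x) μ ν := by
  simp only [curlV, cdV_transport]

/-- **the curl form is transported**: `curlSq_{n·L}(R′∘sites)(W′∘sites) = curlSq(R′)(W′)`. [folklore] -/
theorem curlSq_transport (R' : Tor (fine L (fine n M)) → Fin d → (E →L[ℂ] E)) (W' : Tor (fine L (fine n M)) → Fin d → E) :
    curlSq (fine (n * L) M) (Rtrv n L M R') (W' ∘ sites n L M) = curlSq (fine L (fine n M)) R' W' := by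
  unfold curlSq
  simp_rw [curlV_transport]
  exact Equiv.sum_comp (sites n L M) (fun y => ∑ μ, ∑ ν, ‖curlV (fine L (fine n M)) R' W' y μ ν‖ ^ 2)

omit [NormedSpace ℂ E] in
/-- the `ℓ²` masses of 1-forms are transported. [folklore] -/
theorem nsqV_transport (W' : Tor (fine L (fine n M)) → Fin d → E) : nsqV (fine (n * L) M) (W' ∘ sites n L M) = nsqV (fine L (fine n M)) W' := by
  unfold nsqV
  exact Equiv.sum_comp (sites n L M) (fun y => ∑ μ, ‖W' y μ‖ ^ 2)

/-- leaf-03-g4's rough form is transported: `rough_{n·L}(R′∘sites)(W′∘sites) = rough_L(R′)(W′)` (two-run carrier `fine L (fine n M)`). [folklore] -/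
theorem roughV_transport (R' : Tor (fine L (fine n M)) → Fin d → (E →L[ℂ] E)) (W' : Tor (fine L (fine n M)) → Fin d → E) :
    roughV (n * L) M (Rtrv n L M R') (W' ∘ sites n L M) = roughV L (fine n M) R' W' := by
  unfold roughV
  refine Finset.sum_congr rfl fun ν _ => Finset.sum_congr rfl fun μ _ => ?_
  simp only [Rtrv, Function.comp_apply, sites_add, sites_unitVec]
  exact Equiv.sum_comp (sites n L M) (fun y => ‖R' y ν (W' (y + unitVec (fine L (fine n M)) ν) μ) - W' y μ‖ ^ 2)

/-- **the TRANSPORTED gauge∕curvature functional**: the fine functional `G′` read on level-`n·L` fields, `Gtr G′ W := G′ (W ∘ sites⁻¹)`. [folklore] -/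
def Gtr (G' : (Tor (fine L (fine n M)) → Fin d → E) → ℝ) (W : Tor (fine (n * L) M) → Fin d → E) : ℝ := G' (W ∘ (sites n L M).symm)

omit [NeZero n] [NeZero L] hM [NormedAddCommGroup E] [NormedSpace ℂ E] in
/-- `(W ∘ sites⁻¹) ∘ sites = W`. [folklore] -/
theorem comp_symm_comp (W : Tor (fine (n * L) M) → Fin d → E) : (W ∘ (sites n L M).symm) ∘ sites n L M = W := by
  funext x; simp

omit [NeZero n] [NeZero L] hM [NormedAddCommGroup E] [NormedSpace ℂ E] in
/-- `(W′ ∘ sites) ∘ sites⁻¹ = W′`. [folklore] -/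
theorem comp_comp_symm (W' : Tor (fine L (fine n M)) → Fin d → E) : (W' ∘ sites n L M) ∘ (sites n L M).symm = W' := by
  funext y; simp

omit [NeZero n] [NeZero L] hM [NormedAddCommGroup E] [NormedSpace ℂ E] in
/-- the transported functional on a transported field is the fine functional: `Gtr G′ (W′ ∘ sites) = G′ W′`. [folklore] -/
theorem Gtr_transport (G' : (Tor (fine L (fine n M)) → Fin d → E) → ℝ) (W' : Tor (fine L (fine n M)) → Fin d → E) :
    Gtr n L M G' (W' ∘ sites n L M) = G' W' := by
  unfold Gtr; rw [comp_comp_symm]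

omit [NeZero n] [NeZero L] hM [NormedAddCommGroup E] [NormedSpace ℂ E] in
/-- (GF0) passes: `0 ≤ G′ ⟹ 0 ≤ Gtr G′`. [folklore] -/
theorem Gtr_nonneg {G' : (Tor (fine L (fine n M)) → Fin d → E) → ℝ} (hG0' : ∀ W', 0 ≤ G' W') (W : Tor (fine (n * L) M) → Fin d → E) :
    0 ≤ Gtr n L M G' W := hG0' _

omit [NeZero n] [NeZero L] hM [NormedSpace ℂ E] in
/-- continuity passes. [folklore] -/
theorem continuous_Gtr {G' : (Tor (fine L (fine n M)) → Fin d → E) → ℝ} (hGc' : Continuous G') : Continuous (Gtr n L M G') := by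
  unfold Gtr
  exact hGc'.comp (continuous_pi fun y => continuous_apply ((sites n L M).symm y))

/-- (GF1′) passes: `G′ ≤ C_G·rough + C₀·Σ‖·‖²` at the fine level ⟹ the same for `Gtr G′` against the transported bond transports at level `n·L`. [folklore] -/
theorem Gtr_rough_le {R' : Tor (fine L (fine n M)) → Fin d → (E →L[ℂ] E)} {G' : (Tor (fine L (fine n M)) → Fin d → E) → ℝ} {CG C₀ : ℝ}
    (hG' : ∀ W', G' W' ≤ CG * roughV L (fine n M) R' W' + C₀ * nsqV (fine L (fine n M)) W') (W : Tor (fine (n * L) M) → Fin d → E) :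
    Gtr n L M G' W ≤ CG * roughV (n * L) M (Rtrv n L M R') W + C₀ * nsqV (fine (n * L) M) W := by
  have hW : (W ∘ (sites n L M).symm) ∘ sites n L M = W := comp_symm_comp n L M W
  have h1 : roughV L (fine n M) R' (W ∘ (sites n L M).symm) = roughV (n * L) M (Rtrv n L M R') W := by
    rw [← roughV_transport n L M R', hW]
  have h2 : nsqV (fine L (fine n M)) (W ∘ (sites n L M).symm) = nsqV (fine (n * L) M) W := by
    rw [← nsqV_transport n L M, hW]
  have h := hG' (W ∘ (sites n L M).symm)
  rw [h1, h2] at h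
  exact h

/-- **the FINE member's form IS the level-`n·L` vector form on the transported data**: `SfV n L M R′ G′ W′ = ScV (n·L) M (Rtrv R′) (Gtr G′) (W′ ∘ sites)`. [folklore] -/
theorem SfV_eq_transport (R' : Tor (fine L (fine n M)) → Fin d → (E →L[ℂ] E)) (G' : (Tor (fine L (fine n M)) → Fin d → E) → ℝ)
    (W' : Tor (fine L (fine n M)) → Fin d → E) :
    SfV n L M R' G' W' = ScV (n * L) M (Rtrv n L M R') (Gtr n L M G') (W' ∘ sites n L M) := by
  unfold SfV ScV
  rw [curlSq_transport, Gtr_transport]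
  push_cast
  ring

omit [NormedSpace ℂ E] in
/-- the P⁺ sizes agree: `qVV n L M W′ = qWV (n·L) M (W′ ∘ sites)`. [folklore] -/
theorem qVV_eq_transport (W' : Tor (fine L (fine n M)) → Fin d → E) : qVV n L M W' = qWV (n * L) M (W' ∘ sites n L M) := by
  unfold qVV qWV
  rw [nsqV_transport]
  push_cast
  ring

omit [NeZero n] [NeZero L] in
/-- V-COMP-L read on a level-`n·L` field: `Q_T (Q_{T′} (W ∘ sites⁻¹)) = Q_{T⊛T′} W`. [folklore] -/
theorem QvL_comp_symm (T : Tor M → (Fin d → Fin n) → Fin n → Fin d → (E →L[ℂ] E))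
    (T' : Tor (fine n M) → (Fin d → Fin L) → Fin L → Fin d → (E →L[ℂ] E)) (W : Tor (fine (n * L) M) → Fin d → E) :
    QvL n M T (QvL L (fine n M) T' (W ∘ (sites n L M).symm)) = QvL (n * L) M (compL n L M T T') W := by
  rw [QvL_comp]
  congr 1
  funext x μ
  simp

omit [NeZero n] [NeZero L] in
/-- V-COMP-L with the transported field written as a composition: `Q_T (Q_{T′} W′) = Q_{T⊛T′} (W′ ∘ sites)`. [folklore] -/
theorem QvL_comp' (T : Tor M → (Fin d → Fin n) → Fin n → Fin d → (E →L[ℂ] E))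
    (T' : Tor (fine n M) → (Fin d → Fin L) → Fin L → Fin d → (E →L[ℂ] E)) (W' : Tor (fine L (fine n M)) → Fin d → E) :
    QvL n M T (QvL L (fine n M) T' W') = QvL (n * L) M (compL n L M T T') (W' ∘ sites n L M) :=
  QvL_comp n L M T T' W'

/-- leaf V-P's coercivity SHAPE passes from the canonical-pair presentation (fine member) to the composite ∕ transported data at level `n·L`. [folklore] -/
theorem coerciveV_transport {R' : Tor (fine L (fine n M)) → Fin d → (E →L[ℂ] E)} {G' : (Tor (fine L (fine n M)) → Fin d → E) → ℝ}
    {T : Tor M → (Fin d → Fin n) → Fin n → Fin d → (E →L[ℂ] E)} {T' : Tor (fine n M) → (Fin d → Fin L) → Fin L → Fin d → (E →L[ℂ] E)} {CP : ℝ}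
    (hPf : ∀ W', qVV n L M W' ≤ CP * (SfV n L M R' G' W' + nsqV M (QvL n M T (QvL L (fine n M) T' W'))))
    (W : Tor (fine (n * L) M) → Fin d → E) :
    qWV (n * L) M W ≤ CP * (ScV (n * L) M (Rtrv n L M R') (Gtr n L M G') W + nsqV M (QvL (n * L) M (compL n L M T T') W)) := by
  have h := hPf (W ∘ (sites n L M).symm)
  rw [qVV_eq_transport, SfV_eq_transport, QvL_comp_symm, comp_symm_comp] at h
  exact h

end Transport

/-! ## §2 The fine member of the vector canonical pair as a coarse object at level `n·L` -/

section Pair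

variable (n L : ℕ) [NeZero n] [NeZero L] (M : Fin d → ℕ) [hM : ∀ μ, NeZero (M μ)]

/-- **`blockSpin (Q_T ∘ Q_{T′}) SfV = blockSpin Q_{T⊛T′} ScV_{n·L}` on the composite ∕ transported data** (`VariationalTower.blockSpin_equiv` along
`W′ ↦ W′ ∘ sites`, V-COMP-L `QvL_comp` for the constraint, `SfV_eq_transport` for the form). [folklore] -/
theorem blockSpin_vector_pair_transport (T : Tor M → (Fin d → Fin n) → Fin n → Fin d → (E →L[ℂ] E))
    (T' : Tor (fine n M) → (Fin d → Fin L) → Fin L → Fin d → (E →L[ℂ] E)) (R' : Tor (fine L (fine n M)) → Fin d → (E →L[ℂ] E))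
    (G' : (Tor (fine L (fine n M)) → Fin d → E) → ℝ) (φ : Tor M → Fin d → E) :
    blockSpin (QvL n M T ∘ QvL L (fine n M) T') (SfV n L M R' G') φ
      = blockSpin (QvL (n * L) M (compL n L M T T')) (ScV (n * L) M (Rtrv n L M R') (Gtr n L M G')) φ := by
  symm
  refine blockSpin_equiv ((sites n L M).symm.arrowCongr (Equiv.refl (Fin d → E))) (fun W' => ?_) (fun W' => ?_) φ
  · have harr : (sites n L M).symm.arrowCongr (Equiv.refl (Fin d → E)) W' = W' ∘ sites n L M := by
      funext x; simp [Equiv.arrowCongr_apply]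
    rw [harr, Function.comp_apply, QvL_comp']
  · have harr : (sites n L M).symm.arrowCongr (Equiv.refl (Fin d → E)) W' = W' ∘ sites n L M := by
      funext x; simp [Equiv.arrowCongr_apply]
    rw [harr, SfV_eq_transport]

/-- the vector canonical-pair bracket in the level-`n·L` coarse presentation. [folklore] -/
theorem vector_bracket_transport {R : Tor (fine n M) → Fin d → (E →L[ℂ] E)} {R' : Tor (fine L (fine n M)) → Fin d → (E →L[ℂ] E)}
    {G : (Tor (fine n M) → Fin d → E) → ℝ} {G' : (Tor (fine L (fine n M)) → Fin d → E) → ℝ}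
    {T : Tor M → (Fin d → Fin n) → Fin n → Fin d → (E →L[ℂ] E)} {T' : Tor (fine n M) → (Fin d → Fin L) → Fin L → Fin d → (E →L[ℂ] E)}
    {e e' : ℝ} {φ : Tor M → Fin d → E}
    (hbr : blockSpin (QvL n M T) (ScV n M R G) φ ≤ blockSpin (QvL n M T ∘ QvL L (fine n M) T') (SfV n L M R' G') φ + e * nsqV M φ ∧
      blockSpin (QvL n M T ∘ QvL L (fine n M) T') (SfV n L M R' G') φ ≤ blockSpin (QvL n M T) (ScV n M R G) φ + e' * nsqV M φ) :
    blockSpin (QvL n M T) (ScV n M R G) φ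
        ≤ blockSpin (QvL (n * L) M (compL n L M T T')) (ScV (n * L) M (Rtrv n L M R') (Gtr n L M G')) φ + e * nsqV M φ ∧
      blockSpin (QvL (n * L) M (compL n L M T T')) (ScV (n * L) M (Rtrv n L M R') (Gtr n L M G')) φ
        ≤ blockSpin (QvL n M T) (ScV n M R G) φ + e' * nsqV M φ := by
  rw [← blockSpin_vector_pair_transport]; exact hbr

/-! ### the one-step line-indexed average as a map between consecutive tower levels -/

/-- the one-step line-indexed average from level-`n·L` fields to level-`n` fields: `Q₁ W := Q_{T′} (W ∘ sites⁻¹)`. [folklore] -/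
def Q1towV (T' : Tor (fine n M) → (Fin d → Fin L) → Fin L → Fin d → (E →L[ℂ] E)) (W : Tor (fine (n * L) M) → Fin d → E) :
    Tor (fine n M) → Fin d → E :=
  QvL L (fine n M) T' (W ∘ (sites n L M).symm)

omit [NeZero n] [NeZero L] in
/-- **V-COMP IN TOWER SHAPE**: `Q_{T⊛T′} = Q_T ∘ Q₁` on level-`n·L` fields. [folklore] -/
theorem QvL_compL_eq_comp (T : Tor M → (Fin d → Fin n) → Fin n → Fin d → (E →L[ℂ] E))
    (T' : Tor (fine n M) → (Fin d → Fin L) → Fin L → Fin d → (E →L[ℂ] E)) :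
    QvL (n * L) M (compL n L M T T') = QvL n M T ∘ Q1towV n L M T' := by
  funext W
  exact (QvL_comp_symm n L M T T' W).symm

/-- the level-`n·L` vector form on transported data is the fine member's form: `ScV (n·L) M (Rtrv R′) (Gtr G′) W = SfV n L M R′ G′ (W ∘ sites⁻¹)`. [folklore] -/
theorem ScV_Rtrv_eq (R' : Tor (fine L (fine n M)) → Fin d → (E →L[ℂ] E)) (G' : (Tor (fine L (fine n M)) → Fin d → E) → ℝ)
    (W : Tor (fine (n * L) M) → Fin d → E) :
    ScV (n * L) M (Rtrv n L M R') (Gtr n L M G') W = SfV n L M R' G' (W ∘ (sites n L M).symm) := by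
  rw [SfV_eq_transport, comp_symm_comp]

/-- the one-step vector block-spin value in tower shape: `blockSpin Q₁ (ScV (n·L) (Rtrv R′) (Gtr G′)) W = blockSpin Q_{T′} (SfV R′ G′) W` (the `hONE` slot in
tower shape reads the canonical pair's V-ONE). [folklore] -/
theorem blockSpin_Q1towV (T' : Tor (fine n M) → (Fin d → Fin L) → Fin L → Fin d → (E →L[ℂ] E)) (R' : Tor (fine L (fine n M)) → Fin d → (E →L[ℂ] E))
    (G' : (Tor (fine L (fine n M)) → Fin d → E) → ℝ) (W : Tor (fine n M) → Fin d → E) :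
    blockSpin (Q1towV n L M T') (ScV (n * L) M (Rtrv n L M R') (Gtr n L M G')) W = blockSpin (QvL L (fine n M) T') (SfV n L M R' G') W := by
  refine blockSpin_equiv ((sites n L M).symm.arrowCongr (Equiv.refl (Fin d → E))) (fun W' => ?_) (fun W' => ?_) W
  · have harr : (sites n L M).symm.arrowCongr (Equiv.refl (Fin d → E)) W' = W' ∘ sites n L M := by
      funext x; simp [Equiv.arrowCongr_apply]
    rw [harr, Q1towV, comp_comp_symm]
  · have harr : (sites n L M).symm.arrowCongr (Equiv.refl (Fin d → E)) W' = W' ∘ sites n L M := by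
      funext x; simp [Equiv.arrowCongr_apply]
    rw [harr, SfV_eq_transport]

/-- leaf V-UB's shape passes between the presentations: a fine witness for the composite constraint IS a level-`n·L` witness on the composite ∕ transported data,
and conversely. [folklore] -/
theorem ubV_transport {R' : Tor (fine L (fine n M)) → Fin d → (E →L[ℂ] E)} {G' : (Tor (fine L (fine n M)) → Fin d → E) → ℝ}
    {T : Tor M → (Fin d → Fin n) → Fin n → Fin d → (E →L[ℂ] E)} {T' : Tor (fine n M) → (Fin d → Fin L) → Fin L → Fin d → (E →L[ℂ] E)} {Λ : ℝ}
    {φ : Tor M → Fin d → E} :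
    (∃ W', QvL n M T (QvL L (fine n M) T' W') = φ ∧ SfV n L M R' G' W' ≤ Λ * nsqV M φ) ↔
      (∃ W, QvL (n * L) M (compL n L M T T') W = φ ∧ ScV (n * L) M (Rtrv n L M R') (Gtr n L M G') W ≤ Λ * nsqV M φ) := by
  constructor
  · rintro ⟨W', hW', hb⟩
    exact ⟨W' ∘ sites n L M, by rw [← QvL_comp']; exact hW', by rw [← SfV_eq_transport]; exact hb⟩
  · rintro ⟨W, hW, hb⟩
    exact ⟨W ∘ (sites n L M).symm, by rw [QvL_comp_symm]; exact hW, by rw [← ScV_Rtrv_eq]; exact hb⟩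

end Pair

/-! ## §3 (`E = ℂ`) The averaging MATRIX of the line-indexed class -/

section AvgMatrix

variable (n : ℕ) [NeZero n] (M : Fin d → ℕ) [hM : ∀ μ, NeZero (M μ)]

/-- the line-indexed average `QvL n M T` as a ℂ-linear map on the product index (`E = ℂ`). [folklore] -/
def QvLlin (T : Tor M → (Fin d → Fin n) → Fin n → Fin d → (ℂ →L[ℂ] ℂ)) : (Tor (fine n M) × Fin d → ℂ) →ₗ[ℂ] (Tor M × Fin d → ℂ) where
  toFun w := unc (QvL n M T (cur w))
  map_add' w w' := by
    funext p
    simp only [unc, cur, QvL, Pi.add_apply, map_add, sum_add_distrib, smul_add]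
  map_smul' c w := by
    have h : ∀ (f : ℂ →L[ℂ] ℂ) (v : ℂ), f (c * v) = c * f v := fun f v => by rw [← smul_eq_mul, map_smul, smul_eq_mul]
    funext p
    simp only [unc, cur, QvL, Pi.smul_apply, smul_eq_mul, RingHom.id_apply, h, ← Finset.mul_sum]
    ring

/-- **the averaging MATRIX of `QvL n M T`** on the product index `Tor M × Fin d ← Tor (fine n M) × Fin d`. [folklore] -/
def QmL (T : Tor M → (Fin d → Fin n) → Fin n → Fin d → (ℂ →L[ℂ] ℂ)) : Matrix (Tor M × Fin d) (Tor (fine n M) × Fin d) ℂ :=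
  LinearMap.toMatrix' (QvLlin n M T)

/-- the matrix acts as the average. [folklore] -/
theorem QmL_mulVec (T : Tor M → (Fin d → Fin n) → Fin n → Fin d → (ℂ →L[ℂ] ℂ)) (w : Tor (fine n M) × Fin d → ℂ) :
    QmL n M T *ᵥ w = unc (QvL n M T (cur w)) := by
  rw [QmL, LinearMap.toMatrix'_mulVec]; rfl

/-- **`avg (QmL T) = QvL T`**: `VariationalVectorEffective`'s matrix averaging IS leaf-03-g4's line-indexed class (at `E = ℂ`). [folklore] -/
theorem avg_QmL (T : Tor M → (Fin d → Fin n) → Fin n → Fin d → (ℂ →L[ℂ] ℂ)) (W : Tor (fine n M) → Fin d → ℂ) :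
    avg n M (QmL n M T) W = QvL n M T W := by
  unfold avg
  rw [QmL_mulVec, cur_unc, cur_unc]

/-- the same as an identity of maps. [folklore] -/
theorem avg_QmL_eq (T : Tor M → (Fin d → Fin n) → Fin n → Fin d → (ℂ →L[ℂ] ℂ)) : avg n M (QmL n M T) = QvL n M T :=
  funext (avg_QmL n M T)

/-- surjectivity transfer: `QvL T` onto (e.g. from leaf V-UB-L's exact constraint) ⟹ `(QmL T).mulVec` onto. [folklore] -/
theorem QmL_mulVec_surjective {T : Tor M → (Fin d → Fin n) → Fin n → Fin d → (ℂ →L[ℂ] ℂ)} (h : Function.Surjective (QvL n M T)) :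
    Function.Surjective (QmL n M T).mulVec :=
  (avg_surjective_iff n M (QmL n M T)).1 (by rw [avg_QmL_eq]; exact h)

omit [NeZero n] in
/-- an `∃`-form leaf V-UB (exact constraint for every datum) gives surjectivity of `QvL T`. [folklore] -/
theorem QvL_surjective_of_ub {T : Tor M → (Fin d → Fin n) → Fin n → Fin d → (E →L[ℂ] E)} {S : (Tor (fine n M) → Fin d → E) → ℝ} {Λ : ℝ}
    (hUB : ∀ φ : Tor M → Fin d → E, ∃ W, QvL n M T W = φ ∧ S W ≤ Λ * nsqV M φ) : Function.Surjective (QvL n M T) := fun φ => by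
  obtain ⟨W, hW, -⟩ := hUB φ
  exact ⟨W, hW⟩

end AvgMatrix

/-! ## §4 The vector tower END on the `QvL` carriers, from the canonical-pair brackets and the COMP data identities -/

section Tower

variable (L : ℕ) [NeZero L] (M : Fin d → ℕ) [hM : ∀ μ, NeZero (M μ)]
variable (R : (k : ℕ) → Tor (fine (L ^ k) M) → Fin d → (ℂ →L[ℂ] ℂ))
variable (R' : (k : ℕ) → Tor (fine L (fine (L ^ k) M)) → Fin d → (ℂ →L[ℂ] ℂ))
variable (Gm : (k : ℕ) → Matrix (Tor (fine (L ^ k) M) × Fin d) (Tor (fine (L ^ k) M) × Fin d) ℂ)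
variable (G : (k : ℕ) → (Tor (fine (L ^ k) M) → Fin d → ℂ) → ℝ)
variable (G' : (k : ℕ) → (Tor (fine L (fine (L ^ k) M)) → Fin d → ℂ) → ℝ)
variable (T : (k : ℕ) → Tor M → (Fin d → Fin (L ^ k)) → Fin (L ^ k) → Fin d → (ℂ →L[ℂ] ℂ))
variable (T' : (k : ℕ) → Tor (fine (L ^ k) M) → (Fin d → Fin L) → Fin L → Fin d → (ℂ →L[ℂ] ℂ))

/-- **ROW NE2's WALL SHAPE FOR THE VECTOR SPECIES ON THE `QvL` CARRIERS, FROM THE CANONICAL-PAIR BRACKETS**: along `n_k = L^k` with line transports `T k`,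
one-step line transports `T′ k`, bond transports `R k` ∕ `R′ k`, PSD `Gm k` with `G k = qform (Gm k) ∘ unc`, `QvL (L^k) M (T k)` onto, leaf-V-P-shaped
coercivity per level, the COMP DATA IDENTITIES (level `k+1`'s line transports are the composite ones, its bond transports and functional the fine ones read
through `sites`) and the two one-sided additive brackets between `Δ^V_k = blockSpin (Q_{T_k}) (ScV_k)` and the FINE member `blockSpin (Q_{T_k} ∘ Q_{T′_k}) (SfV_k)`
(the conclusion shape of `vector_pair_bracket_sqrt` at `n = L^k`) ⟹ `OneStepAveragedLaw (fun _ ↦ 1) 1 (k ↦ X^V_k) (k ↦ max (e k) (e′ k))` for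
`X^V_k = effV (L^k) M (R k) (Gm k) (QmL (L^k) M (T k)) a`. [folklore] -/
theorem oneStepAveragedLaw_effV_of_pairs (hGm : ∀ k, (Gm k).PosSemidef) (hG : ∀ k W, G k W = qform (Gm k) (unc W))
    (hsurj : ∀ k, Function.Surjective (QvL (L ^ k) M (T k))) {CP : ℕ → ℝ}
    (hP : ∀ k W, qWV (L ^ k) M W ≤ CP k * (ScV (L ^ k) M (R k) (G k) W + nsqV M (QvL (L ^ k) M (T k) W)))
    (hTcomp : ∀ k, T (k + 1) = compL (L ^ k) L M (T k) (T' k)) (hRtr : ∀ k, R (k + 1) = Rtrv (L ^ k) L M (R' k))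
    (hGtr : ∀ k, G (k + 1) = Gtr (L ^ k) L M (G' k))
    {a : ℝ} (ha : 0 < a) (e e' : ℕ → ℝ) (he : ∀ k, 0 ≤ e k)
    (hbr : ∀ k φ, blockSpin (QvL (L ^ k) M (T k)) (ScV (L ^ k) M (R k) (G k)) φ
        ≤ blockSpin (QvL (L ^ k) M (T k) ∘ QvL L (fine (L ^ k) M) (T' k)) (SfV (L ^ k) L M (R' k) (G' k)) φ + e k * nsqV M φ ∧
      blockSpin (QvL (L ^ k) M (T k) ∘ QvL L (fine (L ^ k) M) (T' k)) (SfV (L ^ k) L M (R' k) (G' k)) φ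
        ≤ blockSpin (QvL (L ^ k) M (T k)) (ScV (L ^ k) M (R k) (G k)) φ + e' k * nsqV M φ) :
    OneStepAveragedLaw (ι := fun _ => Tor M × Fin d) (fun _ => (1 : Matrix (Tor M × Fin d) (Tor M × Fin d) ℂ)) 1
      (fun k => effV (L ^ k) M (R k) (Gm k) (QmL (L ^ k) M (T k)) a) (fun k => max (e k) (e' k)) := by
  refine oneStepAveragedLaw_effV L M R Gm G (fun k => QmL (L ^ k) M (T k)) hGm hG (fun k => QmL_mulVec_surjective _ _ (hsurj k))
    (fun k W => by rw [avg_QmL]; exact hP k W) ha e e' he fun k φ => ?_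
  rw [avg_QmL_eq, avg_QmL_eq]
  have hlev : blockSpin (QvL (L ^ (k + 1)) M (T (k + 1))) (ScV (L ^ (k + 1)) M (R (k + 1)) (G (k + 1))) φ
      = blockSpin (QvL (L ^ k * L) M (compL (L ^ k) L M (T k) (T' k)))
          (ScV (L ^ k * L) M (Rtrv (L ^ k) L M (R' k)) (Gtr (L ^ k) L M (G' k))) φ := by
    rw [hTcomp k, hRtr k, hGtr k]; rfl
  rw [hlev]
  exact vector_bracket_transport (L ^ k) L M (hbr k φ)

/-- **… AND THE SPINE's η-RATE CURRENCY FOR THE VECTOR SPECIES ON THE `QvL` CARRIERS**: the same data with GEOMETRIC brackets (`e k, e′ k ≤ C·ρ^k`, `ρ < 1`)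
⟹ `TowerLimitRate (fun _ ↦ 1) 1 (k ↦ effV (L^k) M (R k) (Gm k) (QmL (L^k) M (T k)) a) C ρ` — the vector effective operators on the unit index `Tor M × Fin d`
CONVERGE with `‖X^V_k − X^V_∞‖ ≤ C·ρ^k∕(1 − ρ)`: THE VECTOR END of road P2 (skeleton §0 ∕ §2.E) on leaf-03-g4's line-indexed carriers, MODULO the vector leaves
V-UB ∕ V-P ∕ V-FED ∕ V-ONE ∕ V-REG (which produce `hbr` through `vector_pair_bracket_sqrt`); V-COMP is DISCHARGED (this file + `VectorLineComposite`). [folklore] -/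
theorem towerLimitRate_effV_of_pairs (hGm : ∀ k, (Gm k).PosSemidef) (hG : ∀ k W, G k W = qform (Gm k) (unc W))
    (hsurj : ∀ k, Function.Surjective (QvL (L ^ k) M (T k))) {CP : ℕ → ℝ}
    (hP : ∀ k W, qWV (L ^ k) M W ≤ CP k * (ScV (L ^ k) M (R k) (G k) W + nsqV M (QvL (L ^ k) M (T k) W)))
    (hTcomp : ∀ k, T (k + 1) = compL (L ^ k) L M (T k) (T' k)) (hRtr : ∀ k, R (k + 1) = Rtrv (L ^ k) L M (R' k))
    (hGtr : ∀ k, G (k + 1) = Gtr (L ^ k) L M (G' k))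
    {a : ℝ} (ha : 0 < a) {C ρ : ℝ} (hC : 0 ≤ C) (hρ : 0 ≤ ρ) (hρ1 : ρ < 1) (e e' : ℕ → ℝ) (he : ∀ k, e k ≤ C * ρ ^ k)
    (he' : ∀ k, e' k ≤ C * ρ ^ k)
    (hbr : ∀ k φ, blockSpin (QvL (L ^ k) M (T k)) (ScV (L ^ k) M (R k) (G k)) φ
        ≤ blockSpin (QvL (L ^ k) M (T k) ∘ QvL L (fine (L ^ k) M) (T' k)) (SfV (L ^ k) L M (R' k) (G' k)) φ + e k * nsqV M φ ∧
      blockSpin (QvL (L ^ k) M (T k) ∘ QvL L (fine (L ^ k) M) (T' k)) (SfV (L ^ k) L M (R' k) (G' k)) φ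
        ≤ blockSpin (QvL (L ^ k) M (T k)) (ScV (L ^ k) M (R k) (G k)) φ + e' k * nsqV M φ) :
    TowerLimitRate (ι := fun _ => Tor M × Fin d) (fun _ => (1 : Matrix (Tor M × Fin d) (Tor M × Fin d) ℂ)) 1
      (fun k => effV (L ^ k) M (R k) (Gm k) (QmL (L ^ k) M (T k)) a) C ρ := by
  refine towerLimitRate_effV L M R Gm G (fun k => QmL (L ^ k) M (T k)) hGm hG (fun k => QmL_mulVec_surjective _ _ (hsurj k))
    (fun k W => by rw [avg_QmL]; exact hP k W) ha hC hρ hρ1 e e' he he' fun k φ => ?_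
  rw [avg_QmL_eq, avg_QmL_eq]
  have hlev : blockSpin (QvL (L ^ (k + 1)) M (T (k + 1))) (ScV (L ^ (k + 1)) M (R (k + 1)) (G (k + 1))) φ
      = blockSpin (QvL (L ^ k * L) M (compL (L ^ k) L M (T k) (T' k)))
          (ScV (L ^ k * L) M (Rtrv (L ^ k) L M (R' k)) (Gtr (L ^ k) L M (G' k))) φ := by
    rw [hTcomp k, hRtr k, hGtr k]; rfl
  rw [hlev]
  exact vector_bracket_transport (L ^ k) L M (hbr k φ)

end Tower

end Summit.QuantumFields.BalabanUV.T4Continuum.VariationalVectorTower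

end
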